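import Literature.NumberTheory.DiophantineGeometry.GenEllDeBadPrimes
import Literature.NumberTheory.DiophantineGeometry.FibreConductorCritJunction
import HarnessLib

/-!
# [GenEll] Thm. 2.1 on the `D_e` route: the bad primes `S(e, A)` of the CRITICAL VALUES, B-free junction

S. Mochizuki, *Arithmetic elliptic curves in general position*, Math. J. Okayama Univ. **52** (2010),
Prop. 1.6 p. 10 / proof of Thm. 2.1 pp. 12–13 [cite: MochizukiGenEll2010, Prop 1.6 p.10]; support file for
the route item `GenEllTwo` (stmt-ABC-19679), W5 package (coordinator abc-iut-w5-d045); classical, nothing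
here bears on [IUTchIII] Cor. 3.12.

`GenEllDeBadPrimes.lean` (abc-iut-w5-d054) packages, for a finite set of values `B ⊂ K`, a finite set of
rational primes `S_bad(e, B)` off which the placewise inequalities `hmeet`/`hoff` hold. In the γ-free route
the set `B = B_T` is mechanism-dependent, so `S_bad(e, B_T)` cannot be fixed before the compactness
argument (finding F2). With the B-free junction `De.hmeet_hoff_of_crit` (`FibreConductorCritJunction.lean`)
the bad primes need only be taken for the subset `A` of CRITICAL VALUES — fixed by `e` (and `c`):

* `De.hmeet_hoff_off_badPrimes_of_crit` — for `k` and a finite `A ⊂ K` there is a finite `S ∋ 2` of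
  rational primes (`= S_bad(e, A)` of `De.exists_badPrimes k A`) such that for EVERY number field `L ⊇ K`,
  every enlargement `T ⊇ S`, every point datum `(r, s, t, N)` of the `D_e` route in `L`, and EVERY finite
  `B ⊆ L` containing the image of `A` with `t ∉ B` — chosen AFTER `S` — the inequalities `hmeet`/`hoff`
  of `FibreConductor.inv_finrank_mul_sum_logNorm_le_slope` hold off `⋃_{p∈T} placesOver L p`, given only
  the converse direction AT `A` there (package W5c: `w(N) < 1 ⇒ t` meets a critical value).

Quantifier order (the point of this file): `∀ A, ∃ S, ∀ L, ∀ T ⊇ S, ∀ point, ∀ B ⊇ A, …`.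
Theorems only.
-/

noncomputable section

namespace Literature.NumberTheory.DiophantineGeometry.GenEll

open _root_.Polynomial NumberField IsDedekindDomain
open Literature.IUT.LogVolume

universe u

variable {K : Type u} [Field K] [NumberField K]

open scoped Classical in
/-- **JUNCTION off the bad primes of the critical values, `B` chosen afterwards.** For `k` and a finite
`A ⊂ K` let `S = S_bad(e, A)` (`De.exists_badPrimes k A`). Then for every number field `L ⊇ K`, every finite
`T ⊇ S`, every point datum (`s² = 1 − 4r^{2k+1}`, `t·(rs) = s + r^{k+2}`,
`N = −s³ + (k+1)r^{k+2} − 2r^{3k+3} ≠ 0`), every finite `B ⊆ L` with `A ⊆ B` (image) and `t ∉ B`, every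
finite `W` which off `Sbad := ⋃_{p∈T} placesOver L p` is the meeting set of `t` with `B`, and given the
converse direction at `A` off `Sbad`: on `W ∖ Sbad`, `1 + ord⁺_w N ≤ Σ_{b∈B} ord⁺_w (t − b)`; off
`W ∪ Sbad`, `ord⁺_w N ≤ Σ_{b∈B} ord⁺_w (t − b)`. Nothing is assumed about `b ∈ B ∖ A`.
[cite: MochizukiGenEll2010, Prop 1.6 p.10] -/
theorem De.hmeet_hoff_off_badPrimes_of_crit (k : ℕ) (A : Finset K) :
    ∃ S : Finset ℕ, 2 ∈ S ∧ (∀ p ∈ S, p.Prime) ∧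
      ∀ (L : Type u) [Field L] [NumberField L] [Algebra K L] (T : Finset ℕ), S ⊆ T →
        ∀ {r s t N : L},
        s ^ 2 = 1 - 4 * r ^ (2 * k + 1) → t * (r * s) = s + r ^ (k + 2) →
        N = -s ^ 3 + (k + 1) * r ^ (k + 2) - 2 * r ^ (3 * k + 3) → N ≠ 0 →
        ∀ (B : Finset L), A.map ⟨algebraMap K L, (algebraMap K L).injective⟩ ⊆ B →
        (∀ b ∈ B, t ≠ b) →
        ∀ W : Finset (HeightOneSpectrum (𝓞 L)),
        (∀ w : HeightOneSpectrum (𝓞 L), w ∉ T.attach.biUnion (fun p => placesOver L p.1) →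
          w.valuation L N < 1 →
            ∃ a ∈ A.map ⟨algebraMap K L, (algebraMap K L).injective⟩, w.valuation L (t - a) < 1) →
        (∀ w : HeightOneSpectrum (𝓞 L), w ∉ T.attach.biUnion (fun p => placesOver L p.1) →
          (w ∈ W ↔ ∃ b ∈ B, 0 < ord L w (t - b))) →
        (∀ w ∈ W, w ∉ T.attach.biUnion (fun p => placesOver L p.1) →
            1 + (ord L w N).toNat ≤ ∑ b ∈ B, (ord L w (t - b)).toNat) ∧
        (∀ w, w ∉ W → w ∉ T.attach.biUnion (fun p => placesOver L p.1) →
            (ord L w N).toNat ≤ ∑ b ∈ B, (ord L w (t - b)).toNat) := by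
  classical
  obtain ⟨S, h2S, hSp, hS⟩ := De.exists_badPrimes (K := K) k A
  refine ⟨S, h2S, hSp, ?_⟩
  intro L _ _ _ T hST r s t N hcurve ht hN hN0 B hAB htB W hconvA hW
  set ι : K ↪ L := ⟨algebraMap K L, (algebraMap K L).injective⟩ with hι
  set Sbad := T.attach.biUnion (fun p => placesOver L p.1) with hSbad
  -- off the larger union one is off the smaller one
  have hmono : ∀ w : HeightOneSpectrum (𝓞 L), w ∉ Sbad →
      w ∉ S.attach.biUnion (fun p => placesOver L p.1) := by
    intro w hw hwS
    obtain ⟨p, -, hp⟩ := Finset.mem_biUnion.mp hwS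
    exact hw (Finset.mem_biUnion.mpr ⟨⟨p.1, hST p.2⟩, Finset.mem_attach _ _, hp⟩)
  refine De.hmeet_hoff_of_crit k hcurve ht hN hN0 (A.map ι) B hAB htB
    (fun c => X ^ (2 * k + 4) + C (4 * c ^ 2) * X ^ (2 * k + 3) - C (8 * c) * X ^ (2 * k + 2)
      + C 4 * X ^ (2 * k + 1) - C (c ^ 2) * X ^ 2 + C (2 * c) * X - 1)
    (fun _ _ => rfl) Sbad W ?_ ?_ ?_ hconvA hW
  · intro w hw
    exact (hS L w (hmono w hw)).1
  · intro w hw a ha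
    obtain ⟨a₀, ha₀, rfl⟩ := Finset.mem_map.mp ha
    exact (hS L w (hmono w hw)).2.1 a₀ ha₀
  · intro w hw a ha ρ hρ hg0 hlt
    obtain ⟨a₀, ha₀, rfl⟩ := Finset.mem_map.mp ha
    exact (hS L w (hmono w hw)).2.2.2 a₀ ha₀ _ rfl ρ hρ hg0 hlt

end Literature.NumberTheory.DiophantineGeometry.GenEll

end
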